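import Mathlib.Analysis.Complex.RemovableSingularity
import Mathlib.Analysis.SpecialFunctions.Pow.Deriv
import Mathlib.Analysis.SpecialFunctions.Gaussian.GaussianIntegral
import Mathlib.MeasureTheory.Integral.DominatedConvergence
import Mathlib.MeasureTheory.Group.Integral
import Mathlib.MeasureTheory.Measure.Lebesgue.Integral
import Literature.NumberTheory.LFunctions.DeBruijnNewmanProofs
import Literature.NumberTheory.LFunctions.EquivalentsProofs
import Literature.Analysis.Complex.HadamardGenusZero
import HarnessLib

/-!
# Newman's theorem: some `H_t` has a non-real zero (`Λ > −∞`) — proof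

Trunk T-ANT, `Literature/NumberTheory/LFunctions`; companion ("Proofs") file of `DeBruijnNewman.lean`
and `Equivalents.lean`. We prove the genuinely new half of

* C. M. Newman, *Fourier transforms with only real zeros*, Proc. AMS 61 (1976), 245–251,
  **Theorem 3**: "there exists a real number `b₀` with `−1/8 ≤ b₀ < ∞` such that `Ξ_b` has only
  real zeros when `b ≤ b₀` but has nonreal zeros when `b > b₀`",

namely `b₀ < ∞`: in de Bruijn's / Rodgers–Tao's time parameter (`H_t = Literature.deBruijnH t`, Newman's
`b` being a negative multiple of `t`), **some `H_t` has a non-real zero**, i.e. the de Bruijn–Newman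
constant satisfies `Λ > −∞`. This is exactly the named fact
`Literature.NumberTheory.LFunctions.exists_not_hasOnlyRealZeros_deBruijnH` of
`Literature/NumberTheory/LFunctions/EquivalentsProofs.lean` (`∃ t, ¬ HasOnlyRealZeros (deBruijnH t)`),
and we prove it modulo Hadamard:

* `Literature.Newman.exists_not_hasOnlyRealZeros_deBruijnH_of_hadamard (hH : hadamard_genus_zero) :
    RH.exists_not_hasOnlyRealZeros_deBruijnH`.

The only input not proved in this file is Hadamard's factorisation theorem in genus zero, the
named fact `Literature.Analysis.Complex.hadamard_genus_zero` (`Literature/Analysis/Complex/HadamardGenusZero.lean`,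
Conway 1978, Ch. XI, Thm. 3.4; discharged in `HadamardGenusZeroProofs.lean` as
`hadamard_genus_zero_holds`, after which the discharge of the fact is the one-liner
`exists_not_hasOnlyRealZeros_deBruijnH_of_hadamard hadamard_genus_zero_holds`). The other half of
Theorem 3 (`b₀ ≥ −1/8`, real zeros persist) is de Bruijn's theorem (`Literature.NumberTheory.LFunctions.de_bruijn_strip`); the
assembly of Newman's characterisation `H_t has only real zeros ↔ Λ ≤ t` from these pieces is
`hasOnlyRealZeros_deBruijnH_iff_deBruijnNewmanConst_le_of_newman_of_strip` in `EquivalentsProofs.lean`.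

## The proof (Newman 1976, §2, specialised to `dρ = Φ(|s|) ds`)

Newman proves Theorem 3 from his Theorem 2, the classification of all even finite measures `ρ`
whose Gaussian tilts `e^{−bs²} dρ(s)` (`b > 0`) all have Fourier transforms with only real zeros:
they are the measures (1.7)/(1.8), whose densities are bounded below by `K t^{2m} exp(−αt⁴ − Bt²)`
((1.9)), which the kernel `F = Φ` violates by its decay (1.3). We run Newman's proof of the necessity
part of Theorem 2 (§2: (2.1)–(2.5) and Lemmas 1–4) directly for the measure `Φ(|s|) ds`, where it
simplifies considerably (no weak limits of measures, no Hurwitz/Montel step, and Hadamard's theorem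
is only needed in genus **zero**):

1. (`coshTransform`, `evenLift`) Suppose every `H_t` has only real zeros. For real `x`,
   `H_t(ix) = ∫₀^∞ e^{tu²} Φ(u) cosh(xu) du` (Newman's `Z_{−t}(x)/2`, (1.6)), and
   `G_t(w) = H_t(i√w)` is an entire function of `w` (an even entire function is entire in `z²`:
   `differentiable_comp_cpow_half`, two branches of `√` plus a removable singularity) of order
   `≤ 3/4 < 1` (`norm_evenLift_le`: `‖H_t(z)‖ ≤ K exp(|Im z|^{3/2})` by the super-exponential decay
   of `Φ` and the Young-type inequality `Yu ≤ Y√Y + u³`), with `G_t(0) = H_t(0) > 0` and — by the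
   hypothesis — only negative real zeros (`evenLift_eq_zero_imp`).
2. (`exists_hasProd_coshTransform`, Newman's (2.1) without the exponential factor) Hadamard in genus
   zero gives `H_t(ix)/H_t(0) = ∏ₙ (1 + βₙ x²)` with `βₙ ≥ 0`, `∑ βₙ < ∞`.
3. (`density`, `density_rep`, Newman's (2.2)) Hence Newman's density
   `f_b(t) = √b e^{−bt²/2} ∫₀^∞ e^{−bs²/2} Φ(s) cosh(bts) ds` — the density of the convolution of
   `Φ(|s|) ds` with the centred Gaussian of variance `1/b`, up to the constant factor `√(π/2)`
   (`gaussConst`; the true density is `√(b/2π) e^{−bt²/2} · 2∫₀^∞ …`) — satisfies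
   `log f_b(t) = κ_b − bt²/2 + ∑ₙ log(1 + αₙ t²)`, `αₙ = βₙ b² ≥ 0` summable.
4. (`logPotential_sub_one_le`, Newman's (2.4)–(2.5), (2.16)–(2.18), made effective) For any such
   `V(t) = Bt² − ∑ log(1 + αₙt²)` and `t ≥ 1`:
   `V(t) − V(1) ≤ Q · t⁴`, where `Q` is a fixed continuous function of the four values
   `V(1/2), V(1), V(2), V(3)` (`fourPoint`). This replaces Newman's Lemmas 2–4: the quantities
   `A_b`, `B_b` of (2.3) are controlled by finitely many values of `V_b`, using only
   `log y ≤ y − 1` and `1 − 1/y ≤ log y` termwise.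
5. (`tendsto_density`) `f_b(t) → c₀ Φ(|t|)` as `b → ∞` for every `t` (`c₀ = √(π/2)`): after the
   substitution `s = t + v/√b`, `f_b(t) = ½ ∫ e^{−v²/2} Φ(|t + v/√b|) dv`, and dominated convergence
   applies since `Φ` is bounded and continuous on `[0, ∞)`. (This is the trivial case of Newman's
   weak limit `ρ_b → ρ`, his Lemma 1.)
6. (`exists_not_hasOnlyRealZeros_deBruijnH_of_hadamard`) Letting `b → ∞` in 4 (with `V = −log f_b`)
   gives `log Φ(1) − log Φ(t) ≤ M t⁴` for all `t ≥ 1` and a constant `M`, i.e.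
   `Φ(t) ≥ Φ(1) e^{−Mt⁴}` (Newman's (1.9)), contradicting `Φ(t) ≤ C exp(9t − π e^{4t})`
   (`Literature.NumberTheory.LFunctions.deBruijnPhi_le_exp`, Newman's (1.3); `deBruijnPhi_decay`).

All analytic inputs on `Φ` and `H_t` (`Literature.NumberTheory.LFunctions.deBruijnPhi_pos_of_nonneg`, `continuousOn_deBruijnPhi_Ici`,
`abs_deBruijnPhi_le`, `differentiable_deBruijnH_holds`, `integrableOn_deBruijnHBound`, …) come from
`DeBruijnNewmanProofs.lean`; only `Φ|[0, ∞)` is used (through its even extension `evenPhi`), so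
the evenness of `Φ` is not needed.

## References

* C. M. Newman, *Fourier transforms with only real zeros*, Proc. AMS 61 (1976), 245–251, Thm. 3
  and §2 (proof of Thm. 2). [cite: NewmanPAMS1976, Thm. 3]
* J. B. Conway, *Functions of one complex variable I*, 2nd ed. (1978), Ch. XI, Thm. 3.4 (Hadamard).
* B. Rodgers, T. Tao, *The de Bruijn–Newman constant is non-negative*, Forum Math. Pi 8 (2020), §1.
-/

noncomputable section

open Complex Filter Metric Set Topology MeasureTheory Real

namespace Literature.NumberTheory.LFunctions

namespace Newman

/-! ### Even entire functions are entire functions of `z²` -/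

/-- An even function takes equal values at the two square roots of a number. [folklore] -/
theorem even_apply_eq_of_sq_eq {f : ℂ → ℂ} (heven : ∀ z, f (-z) = f z) {u v : ℂ}
    (h : u ^ 2 = v ^ 2) : f u = f v := by
  have : (u - v) * (u + v) = 0 := by ring_nf; rw [h]; ring
  rcases mul_eq_zero.1 this with h1 | h1
  · rw [sub_eq_zero.1 h1]
  · rw [show u = -v by linear_combination h1, heven]

/-- If `f` is entire and even then `w ↦ f (w ^ (1/2))` is entire (and equals `f z` at
`w = z²`). [folklore] -/
theorem differentiable_comp_cpow_half {f : ℂ → ℂ} (hf : Differentiable ℂ f)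
    (heven : ∀ z, f (-z) = f z) : Differentiable ℂ fun w : ℂ ↦ f (w ^ (2⁻¹ : ℂ)) := by
  set density : ℂ → ℂ := fun w ↦ f (w ^ (2⁻¹ : ℂ)) with hF
  -- second branch
  have hF2 : density = fun w ↦ f (I * (-w) ^ (2⁻¹ : ℂ)) := by
    funext w
    apply even_apply_eq_of_sq_eq heven
    rw [mul_pow, cpow_ofNat_inv_pow, cpow_ofNat_inv_pow, I_sq]; ring
  have hdiff_ne : ∀ w : ℂ, w ≠ 0 → DifferentiableAt ℂ density w := by
    intro w hw
    rcases mem_slitPlane_or_neg_mem_slitPlane hw with h | h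
    · exact (hf _).comp w (differentiableAt_id.cpow_const h)
    · rw [hF2]
      exact (hf _).comp w ((differentiableAt_id.neg.cpow_const h).const_mul I)
  intro w
  rcases eq_or_ne w 0 with rfl | hw
  · refine (analyticAt_of_differentiable_on_punctured_nhds_of_continuousAt ?_ ?_).differentiableAt
    · exact eventually_nhdsWithin_of_forall fun z hz ↦ hdiff_ne z hz
    · exact (hf.continuous.continuousAt).comp
        (continuousAt_cpow_const_of_re_pos (Or.inl le_rfl) (by norm_num))
  · exact hdiff_ne w hw

/-- For even `f`: `f ((z²)^{1/2}) = f z`. [folklore] -/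
theorem comp_cpow_half_apply_sq {f : ℂ → ℂ} (heven : ∀ z, f (-z) = f z) (z : ℂ) :
    f ((z ^ 2) ^ (2⁻¹ : ℂ)) = f z :=
  even_apply_eq_of_sq_eq heven (cpow_ofNat_inv_pow _ 2)

/-! ### Infinite products with a vanishing factor -/

/-- An unconditionally convergent product with a vanishing factor vanishes. [folklore] -/
theorem eq_zero_of_hasProd_of_eq_zero {g : ℕ → ℂ} {a : ℂ} (h : HasProd g a) {k : ℕ}
    (hk : g k = 0) : a = 0 :=
  h.unique (hasProd_zero_of_exists_eq_zero ⟨k, hk⟩)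


/-! ### Growth of `H_t` along the imaginary direction: order `3/2 < 2` -/

/-- `u³ ≤ e^{2u}` for `u ≥ 0`. [folklore] -/
theorem cube_le_exp_two_mul {u : ℝ} (hu : 0 ≤ u) : u ^ 3 ≤ Real.exp (2 * u) := by
  have h := Real.pow_div_factorial_le_exp (x := 2 * u) (by linarith) 3
  have h3 : (Nat.factorial 3 : ℝ) = 6 := by norm_num [Nat.factorial]
  rw [h3] at h
  have h' : (2 * u) ^ 3 ≤ 6 * Real.exp (2 * u) := by
    rw [div_le_iff₀ (by norm_num : (0:ℝ) < 6)] at h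
    linarith
  nlinarith [h', pow_nonneg hu 3, Real.exp_pos (2 * u)]

/-- The dominating function with an extra factor `e^{u³}`: `e^{T u²} |Φ(u)| e^{u³}`. [folklore] -/
def cubeBound (T : ℝ) (u : ℝ) : ℝ :=
  Real.exp (T * u ^ 2) * |deBruijnPhi u| * Real.exp (u ^ 3)

/-- The dominating function is nonnegative. [folklore] -/
theorem cubeBound_nonneg (T u : ℝ) : 0 ≤ cubeBound T u := by
  unfold cubeBound; positivity

/-- The dominating function is continuous on `[0, ∞)`. [folklore] -/
theorem continuousOn_cubeBound (T : ℝ) : ContinuousOn (cubeBound T) (Ici 0) := by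
  have h1 : Continuous fun u : ℝ ↦ Real.exp (T * u ^ 2) := by fun_prop
  have h2 : Continuous fun u : ℝ ↦ Real.exp (u ^ 3) := by fun_prop
  exact (h1.continuousOn.mul (continuous_abs.comp_continuousOn continuousOn_deBruijnPhi_Ici)).mul
    h2.continuousOn

/-- Integrability of `e^{T u²} |Φ(u)| e^{u³}` on `(0, ∞)`: as for `deBruijnHBound`,
`T u² + u³ + 10 u ≤ A e^{2u}` and `A e^{2u} − π e^{4u} ≤ A²/(4π)`. [folklore] -/
theorem integrableOn_cubeBound (T : ℝ) : IntegrableOn (cubeBound T) (Ioi 0) := by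
  obtain ⟨C, hC⟩ : ∃ C, ∀ u, 0 ≤ u → |deBruijnPhi u| ≤ C * Real.exp (9 * u - π * Real.exp (4 * u)) :=
    ⟨_, fun u hu ↦ abs_deBruijnPhi_le hu⟩
  set A : ℝ := |T| + 11 with hA
  set K : ℝ := A ^ 2 / (4 * π) with hK
  have hg : IntegrableOn (fun u : ℝ ↦ |C| * Real.exp K * Real.exp (-u)) (Ioi 0) :=
    (integrableOn_exp_neg_Ioi 0).const_mul _
  refine hg.mono' ((continuousOn_cubeBound T).mono Ioi_subset_Ici_self
    |>.aestronglyMeasurable measurableSet_Ioi) (ae_restrict_of_forall_mem measurableSet_Ioi ?_)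
  intro u (hu : 0 < u)
  have hu' : 0 ≤ u := hu.le
  rw [Real.norm_eq_abs, abs_of_nonneg (cubeBound_nonneg _ _), cubeBound]
  set x : ℝ := Real.exp (2 * u) with hxdef
  have hx : 0 < x := Real.exp_pos _
  have h4 : Real.exp (4 * u) = x ^ 2 := by
    rw [hxdef, ← Real.exp_nat_mul]; ring_nf
  have hpoly : T * u ^ 2 + u ^ 3 + 9 * u + u ≤ A * x := by
    have h1 : T * u ^ 2 ≤ |T| * x :=
      (mul_le_mul_of_nonneg_right (le_abs_self T) (sq_nonneg u)).trans
        (mul_le_mul_of_nonneg_left (sq_le_exp_two_mul hu') (abs_nonneg T))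
    have h2 : u ^ 3 ≤ x := cube_le_exp_two_mul hu'
    have h3 : 9 * u + u ≤ 10 * x := by linarith [self_le_exp_two_mul hu']
    rw [hA]; linarith
  have hquad : A * x - π * Real.exp (4 * u) ≤ K := by
    rw [h4, hK]
    have hπ : (0 : ℝ) < 4 * π := by positivity
    have hid : A * x - π * x ^ 2 = A ^ 2 / (4 * π) - (A - 2 * π * x) ^ 2 / (4 * π) := by
      field_simp
      ring
    rw [hid]
    linarith [div_nonneg (sq_nonneg (A - 2 * π * x)) hπ.le]
  have hexp : Real.exp (T * u ^ 2) * Real.exp (9 * u - π * Real.exp (4 * u)) * Real.exp (u ^ 3) ≤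
      Real.exp K * Real.exp (-u) := by
    rw [← Real.exp_add, ← Real.exp_add, ← Real.exp_add]
    exact Real.exp_monotone (by linarith)
  calc Real.exp (T * u ^ 2) * |deBruijnPhi u| * Real.exp (u ^ 3)
      ≤ Real.exp (T * u ^ 2) * (|C| * Real.exp (9 * u - π * Real.exp (4 * u))) *
          Real.exp (u ^ 3) := by
        gcongr
        exact (hC u hu').trans (by gcongr; exact le_abs_self C)
    _ = |C| * (Real.exp (T * u ^ 2) * Real.exp (9 * u - π * Real.exp (4 * u)) *
          Real.exp (u ^ 3)) := by ring
    _ ≤ |C| * (Real.exp K * Real.exp (-u)) := by gcongr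
    _ = |C| * Real.exp K * Real.exp (-u) := by ring

/-- Young-type inequality `Y u ≤ Y √Y + u³` for `Y, u ≥ 0`. [folklore] -/
theorem mul_le_mul_sqrt_add_cube {Y u : ℝ} (hY : 0 ≤ Y) (hu : 0 ≤ u) :
    Y * u ≤ Y * Real.sqrt Y + u ^ 3 := by
  rcases le_or_gt u (Real.sqrt Y) with h | h
  · nlinarith [mul_le_mul_of_nonneg_left h hY, pow_nonneg hu 3]
  · have h1 : Y < u ^ 2 := by
      have hs := Real.sq_sqrt hY
      nlinarith [Real.sqrt_nonneg Y]
    nlinarith [Real.sqrt_nonneg Y, mul_nonneg hY (Real.sqrt_nonneg Y)]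

/-- Growth of `H_t`: `‖H_t(z)‖ ≤ K_t exp(|Im z| √|Im z|)` — order `3/2` in `z`. [folklore] -/
theorem norm_deBruijnH_le (t : ℝ) : ∃ K : ℝ, 0 ≤ K ∧ ∀ z : ℂ,
    ‖deBruijnH t z‖ ≤ K * Real.exp (|z.im| * Real.sqrt |z.im|) := by
  refine ⟨∫ u in Ioi (0 : ℝ), cubeBound t u, setIntegral_nonneg measurableSet_Ioi
    fun u _ ↦ cubeBound_nonneg t u, fun z ↦ ?_⟩
  set Y : ℝ := |z.im| with hY
  have hY0 : 0 ≤ Y := abs_nonneg _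
  rw [deBruijnH_eq_integral, mul_comm, ← integral_const_mul]
  refine norm_integral_le_of_norm_le ((integrableOn_cubeBound t).const_mul _)
    (ae_restrict_of_forall_mem measurableSet_Ioi fun u (hu : 0 < u) ↦ ?_)
  have hu' : 0 ≤ u := hu.le
  calc ‖deBruijnHIntegrand t z u‖ ≤ deBruijnHBound t Y u :=
        norm_deBruijnHIntegrand_le le_rfl le_rfl hu'
    _ ≤ Real.exp (Y * Real.sqrt Y) * cubeBound t u := by
        unfold deBruijnHBound cubeBound
        have : Real.exp (Y * u) ≤ Real.exp (Y * Real.sqrt Y) * Real.exp (u ^ 3) := by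
          rw [← Real.exp_add]
          exact Real.exp_monotone (mul_le_mul_sqrt_add_cube hY0 hu')
        calc Real.exp (t * u ^ 2) * |deBruijnPhi u| * Real.exp (Y * u)
            ≤ Real.exp (t * u ^ 2) * |deBruijnPhi u| *
                (Real.exp (Y * Real.sqrt Y) * Real.exp (u ^ 3)) := by gcongr
          _ = Real.exp (Y * Real.sqrt Y) * (Real.exp (t * u ^ 2) * |deBruijnPhi u| *
                Real.exp (u ^ 3)) := by ring


/-! ### `H_t` on the imaginary axis: a real `cosh` transform -/

/-- `coshTransform t x = ∫₀^∞ e^{t u²} Φ(u) cosh(x u) du`, the (real) value of `H_t` at `i x`. [folklore] -/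
def coshTransform (t x : ℝ) : ℝ :=
  ∫ u in Ioi (0 : ℝ), Real.exp (t * u ^ 2) * deBruijnPhi u * Real.cosh (x * u)

/-- `H_t(i x) = ∫₀^∞ e^{tu²} Φ(u) cosh(x u) du` for real `x` (`cos(i y) = cosh y`). [folklore] -/
theorem deBruijnH_I_mul (t x : ℝ) : deBruijnH t (I * x) = (coshTransform t x : ℂ) := by
  rw [deBruijnH, coshTransform, ← integral_complex_ofReal]
  refine setIntegral_congr_fun measurableSet_Ioi fun u _ ↦ ?_
  have : I * (x : ℂ) * (u : ℂ) = ((x * u : ℝ) : ℂ) * I := by push_cast; ring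
  rw [this, Complex.cos_mul_I, ← ofReal_cosh]
  push_cast
  ring

/-- At `x = 0` the cosh transform is `H_t(0)`. [folklore] -/
theorem coshTransform_zero_eq (t : ℝ) : (coshTransform t 0 : ℂ) = deBruijnH t 0 := by
  rw [← deBruijnH_I_mul]; simp

/-- `∫₀^∞ e^{tu²} Φ(u) du > 0`. [folklore] -/
theorem coshTransform_zero_pos (t : ℝ) : 0 < coshTransform t 0 := by
  have h := deBruijnH_apply_zero t
  rw [← coshTransform_zero_eq, ofReal_inj] at h
  rw [h]
  exact deBruijnH_apply_zero_pos t

/-! ### Newman's even entire function `G_t(w) = H_t(i √w)` of order `< 1` -/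

/-- `evenLift t w = H_t (i w^{1/2})`; an entire function of `w` with `evenLift t (z ^ 2) = H_t (i z)`. [folklore] -/
def evenLift (t : ℝ) (w : ℂ) : ℂ :=
  deBruijnH t (I * w ^ (2⁻¹ : ℂ))

/-- `z ↦ H_t(i z)` is even. [folklore] -/
theorem deBruijnH_I_mul_even (t : ℝ) (z : ℂ) : deBruijnH t (I * -z) = deBruijnH t (I * z) := by
  rw [mul_neg, deBruijnH_neg]

/-- `w ↦ H_t(i w^{1/2})` is entire (even entire functions are entire in `z²`). [folklore] -/
theorem differentiable_evenLift (t : ℝ) : Differentiable ℂ (evenLift t) :=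
  differentiable_comp_cpow_half (f := fun z ↦ deBruijnH t (I * z))
    ((differentiable_deBruijnH_holds t).comp (differentiable_id.const_mul I))
    (deBruijnH_I_mul_even t)

/-- `G_t(z²) = H_t(i z)`. [folklore] -/
theorem evenLift_sq (t : ℝ) (z : ℂ) : evenLift t (z ^ 2) = deBruijnH t (I * z) :=
  comp_cpow_half_apply_sq (f := fun z ↦ deBruijnH t (I * z)) (deBruijnH_I_mul_even t) z

/-- `G_t(0) = H_t(0)`. [folklore] -/
theorem evenLift_zero (t : ℝ) : evenLift t 0 = deBruijnH t 0 := by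
  simp [evenLift, zero_cpow (by norm_num : (2⁻¹ : ℂ) ≠ 0)]

/-- `G_t(0) = H_t(0) ≠ 0`. [folklore] -/
theorem evenLift_zero_ne_zero (t : ℝ) : evenLift t 0 ≠ 0 := by
  rw [evenLift_zero]; exact deBruijnH_apply_zero_ne_zero t

/-- `G_t(x²) = ∫₀^∞ e^{tu²} Φ(u) cosh(x u) du` for real `x`. [folklore] -/
theorem evenLift_ofReal_sq (t x : ℝ) : evenLift t ((x : ℂ) ^ 2) = (coshTransform t x : ℂ) := by
  rw [evenLift_sq, deBruijnH_I_mul]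

/-- Growth: `‖evenLift t w‖ ≤ K exp(‖w‖ ^ (3/4))`, so `evenLift t` has order `≤ 3/4 < 1`. [folklore] -/
theorem norm_evenLift_le (t : ℝ) : ∃ K : ℝ, 0 ≤ K ∧ ∀ w : ℂ, ‖evenLift t w‖ ≤ K * Real.exp (‖w‖ ^ (3 / 4 : ℝ)) := by
  obtain ⟨K, hK0, hK⟩ := norm_deBruijnH_le t
  refine ⟨K, hK0, fun w ↦ (hK _).trans ?_⟩
  gcongr
  set Y : ℝ := |(I * w ^ (2⁻¹ : ℂ)).im| with hY
  have hY0 : 0 ≤ Y := abs_nonneg _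
  have hYle : Y ≤ ‖w‖ ^ (2⁻¹ : ℝ) := by
    have h1 : Y ≤ ‖w ^ (2⁻¹ : ℂ)‖ := by
      rw [hY, show (I * w ^ (2⁻¹ : ℂ)).im = (w ^ (2⁻¹ : ℂ)).re by simp]
      exact abs_re_le_norm _
    rwa [show (2⁻¹ : ℂ) = ((2⁻¹ : ℝ) : ℂ) by push_cast; ring, norm_cpow_real] at h1
  calc Y * Real.sqrt Y ≤ ‖w‖ ^ (2⁻¹ : ℝ) * Real.sqrt (‖w‖ ^ (2⁻¹ : ℝ)) := by
        gcongr
    _ = ‖w‖ ^ (3 / 4 : ℝ) := by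
        rw [Real.sqrt_eq_rpow, ← Real.rpow_mul (norm_nonneg _), ← Real.rpow_add' (norm_nonneg _)]
        · norm_num
        · norm_num

/-- If `H_t` has only real zeros, every zero `w` of `evenLift t` is a negative real number:
`w = z²` with `H_t(i z) = 0`, so `i z ∈ ℝ`. [folklore] -/
theorem evenLift_eq_zero_imp {t : ℝ} (ht : HasOnlyRealZeros (deBruijnH t)) {w : ℂ}
    (hw : evenLift t w = 0) : w.im = 0 ∧ w.re ≤ 0 := by
  set z : ℂ := w ^ (2⁻¹ : ℂ) with hz
  have h1 : (I * z).im = 0 := ht _ hw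
  have hre : z.re = 0 := by simpa using h1
  have hw' : w = z ^ 2 := (cpow_ofNat_inv_pow w 2).symm
  have hz' : z = (z.im : ℂ) * I := by
    apply Complex.ext <;> simp [hre]
  rw [hw', hz', mul_pow, I_sq]
  constructor
  · simp [pow_two]
  · have : (((z.im : ℂ)) ^ 2 * -1).re = -(z.im ^ 2) := by
      simp [pow_two]
    rw [this]
    nlinarith [sq_nonneg z.im]

/-- HasProd of real numbers from HasProd of their complexifications. [folklore] -/
theorem hasProd_of_ofReal {g : ℕ → ℝ} {a : ℝ} (h : HasProd (fun n ↦ (g n : ℂ)) (a : ℂ)) :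
    HasProd g a := by
  have h' : Tendsto (fun s : Finset ℕ ↦ ((∏ i ∈ s, g i : ℝ) : ℂ)) atTop (𝓝 (a : ℂ)) := by
    have : Tendsto (fun s : Finset ℕ ↦ ∏ i ∈ s, (g i : ℂ)) atTop (𝓝 (a : ℂ)) := h
    simpa [ofReal_prod] using this
  exact (Complex.isometry_ofReal.isEmbedding.tendsto_nhds_iff).2 h'

/-- **Hadamard factorisation of `evenLift t`** (genus zero) when `H_t` has only real zeros:
`coshTransform t x / coshTransform t 0 = ∏ (1 + βₙ x²)` with `βₙ ≥ 0`, `∑ βₙ < ∞`. [cite: NewmanPAMS1976, (2.1)] -/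
theorem exists_hasProd_coshTransform (hH : Literature.Analysis.Complex.hadamard_genus_zero)
    {t : ℝ} (ht : HasOnlyRealZeros (deBruijnH t)) :
    ∃ β : ℕ → ℝ, (∀ n, 0 ≤ β n) ∧ Summable β ∧
      ∀ x : ℝ, HasProd (fun n ↦ 1 + β n * x ^ 2) (coshTransform t x / coshTransform t 0) := by
  obtain ⟨K, -, hK⟩ := norm_evenLift_le t
  obtain ⟨b, hbs, hprod⟩ := hH (evenLift t) (3 / 4) K (differentiable_evenLift t) (by norm_num) hK
    (evenLift_zero_ne_zero t)
  have hb : ∀ n, (b n).im = 0 ∧ (b n).re ≤ 0 := by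
    intro n
    by_cases hn : b n = 0
    · simp [hn]
    · have h0 : evenLift t (b n)⁻¹ = 0 := by
        have h1 := eq_zero_of_hasProd_of_eq_zero (hprod (b n)⁻¹) (k := n)
          (by rw [mul_inv_cancel₀ hn, sub_self])
        rcases div_eq_zero_iff.1 h1 with h | h
        · exact h
        · exact absurd h (evenLift_zero_ne_zero t)
      obtain ⟨him, hre⟩ := evenLift_eq_zero_imp ht h0
      have hreal : (b n)⁻¹ = (((b n)⁻¹).re : ℂ) := Complex.ext (by simp) (by simp [him])
      have hbn : b n = ((((b n)⁻¹).re)⁻¹ : ℝ) := by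
        rw [ofReal_inv, ← hreal, inv_inv]
      refine ⟨by rw [hbn]; exact ofReal_im _, ?_⟩
      rw [hbn, ofReal_re]
      exact inv_nonpos.2 hre
  refine ⟨fun n ↦ -(b n).re, fun n ↦ by linarith [(hb n).2], ?_, fun x ↦ ?_⟩
  · refine Summable.of_norm_bounded hbs fun n ↦ ?_
    rw [Real.norm_eq_abs, abs_neg]
    exact abs_re_le_norm (b n)
  · have h := hprod ((x : ℂ) ^ 2)
    rw [evenLift_ofReal_sq, evenLift_zero, ← coshTransform_zero_eq, ← ofReal_div] at h
    have hterm : (fun n ↦ 1 - b n * (x : ℂ) ^ 2) = fun n ↦ ((1 + -(b n).re * x ^ 2 : ℝ) : ℂ) := by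
      funext n
      have hbn : b n = ((b n).re : ℂ) := Complex.ext (by simp) (by simp [(hb n).1])
      calc 1 - b n * (x : ℂ) ^ 2 = 1 - ((b n).re : ℂ) * (x : ℂ) ^ 2 := by rw [← hbn]
        _ = _ := by push_cast; ring
    rw [hterm] at h
    exact hasProd_of_ofReal h

/-- From the product to the logarithmic series. [folklore] -/
theorem summable_log_one_add {β : ℕ → ℝ} (hβ0 : ∀ n, 0 ≤ β n) (hβ : Summable β) (x : ℝ) :
    Summable fun n ↦ Real.log (1 + β n * x ^ 2) := by
  refine Summable.of_nonneg_of_le (fun n ↦ Real.log_nonneg ?_) (fun n ↦ ?_) (hβ.mul_right (x ^ 2))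
  · nlinarith [hβ0 n, sq_nonneg x]
  · have hpos : 0 < 1 + β n * x ^ 2 := by nlinarith [hβ0 n, sq_nonneg x]
    linarith [Real.log_le_sub_one_of_pos hpos]

/-- A convergent product of positive reals `1 + βₙ x²` is `exp` of the (convergent) sum of
logarithms. [folklore] -/
theorem eq_exp_tsum_log {β : ℕ → ℝ} (hβ0 : ∀ n, 0 ≤ β n) (hβ : Summable β) {x P : ℝ}
    (h : HasProd (fun n ↦ 1 + β n * x ^ 2) P) :
    P = Real.exp (∑' n, Real.log (1 + β n * x ^ 2)) := by
  have hs := (summable_log_one_add hβ0 hβ x).hasSum.rexp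
  have : (rexp ∘ fun n ↦ Real.log (1 + β n * x ^ 2)) = fun n ↦ 1 + β n * x ^ 2 := by
    funext n
    simp only [Function.comp_apply]
    exact Real.exp_log (by nlinarith [hβ0 n, sq_nonneg x])
  rw [this] at hs
  exact h.unique hs

/-! ### Newman's densities `f_b` -/

/-- Newman's density, up to the constant factor `√(π/2) = gaussConst`:
`density b t = √b · e^{−b t²/2} · ∫₀^∞ e^{−b s²/2} Φ(s) cosh(b t s) ds`; the density at `t` of the
convolution of `Φ(|s|) ds` with the centred Gaussian of variance `1/b` is
`density b t / √(π/2)`. [cite: NewmanPAMS1976, (2.2)] -/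
def density (b t : ℝ) : ℝ :=
  Real.sqrt b * Real.exp (-(b * t ^ 2 / 2)) * coshTransform (-(b / 2)) (b * t)

/-- **The product representation of `f_b`** (Newman 1976, (2.2)): for every `b > 0` such that
`H_{−b/2}` has only real zeros there are `κ_b ∈ ℝ` and `αₙ ≥ 0` with `∑ αₙ < ∞` such that
`log f_b(t) = κ_b − b t²/2 + ∑ₙ log(1 + αₙ t²)` for all real `t`. [cite: NewmanPAMS1976, (2.2)] -/
theorem density_rep (hH : Literature.Analysis.Complex.hadamard_genus_zero) {b : ℝ} (hb : 0 < b)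
    (hb' : HasOnlyRealZeros (deBruijnH (-(b / 2)))) :
    ∃ κ : ℝ, ∃ α : ℕ → ℝ, (∀ n, 0 ≤ α n) ∧ Summable α ∧ ∀ t : ℝ,
      0 < density b t ∧ Real.log (density b t) = κ - b * t ^ 2 / 2 + ∑' n, Real.log (1 + α n * t ^ 2) := by
  obtain ⟨β, hβ0, hβ, hprod⟩ := exists_hasProd_coshTransform hH hb'
  have hH0 := coshTransform_zero_pos (-(b / 2))
  refine ⟨Real.log (Real.sqrt b * coshTransform (-(b / 2)) 0), fun n ↦ β n * b ^ 2,
    fun n ↦ by have := hβ0 n; positivity, hβ.mul_right _, fun t ↦ ?_⟩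
  have hα : ∀ n, β n * (b * t) ^ 2 = β n * b ^ 2 * t ^ 2 := fun n ↦ by ring
  have hP := eq_exp_tsum_log hβ0 hβ (hprod (b * t))
  simp_rw [hα] at hP
  set S := ∑' n, Real.log (1 + β n * b ^ 2 * t ^ 2) with hS
  have hval : coshTransform (-(b / 2)) (b * t) = coshTransform (-(b / 2)) 0 * Real.exp S := by
    rw [← hP]; field_simp
  have hsb : 0 < Real.sqrt b := Real.sqrt_pos.2 hb
  have hFt : density b t = Real.sqrt b * coshTransform (-(b / 2)) 0 * Real.exp (-(b * t ^ 2 / 2) + S) := by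
    rw [density, hval, Real.exp_add]; ring
  have hFpos : 0 < density b t := by rw [hFt]; positivity
  refine ⟨hFpos, ?_⟩
  rw [hFt, Real.log_mul (by positivity) (by positivity), Real.log_exp]
  ring


/-! ### The limit `b → ∞`: `f_b(t) → gaussConst Φ(|t|)` -/

/-- The even extension `evenPhi(s) = Φ(|s|)` of `Φ|[0, ∞)`. [folklore] -/
def evenPhi (s : ℝ) : ℝ := deBruijnPhi |s|

/-- `Φ(|s|)` is continuous (from `continuousOn_deBruijnPhi_Ici`). [folklore] -/
theorem continuous_evenPhi : Continuous evenPhi :=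
  continuousOn_deBruijnPhi_Ici.comp_continuous continuous_abs fun s ↦ abs_nonneg s

/-- `Φ(|s|) ≥ 0`. [folklore] -/
theorem evenPhi_nonneg (s : ℝ) : 0 ≤ evenPhi s := (deBruijnPhi_pos_of_nonneg (abs_nonneg s)).le

/-- `Φ(|s|)` is even. [folklore] -/
theorem evenPhi_neg (s : ℝ) : evenPhi (-s) = evenPhi s := by simp [evenPhi]

/-- `Φ(|s|) = Φ(s)` for `s ≥ 0`. [folklore] -/
theorem evenPhi_of_nonneg {s : ℝ} (hs : 0 ≤ s) : evenPhi s = deBruijnPhi s := by rw [evenPhi, abs_of_nonneg hs]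

/-- `Φ(|s|) ≤ ∑ Mₙ` is bounded (from `abs_deBruijnPhi_le`). [folklore] -/
theorem exists_evenPhi_le : ∃ C : ℝ, 0 ≤ C ∧ ∀ s, evenPhi s ≤ C := by
  refine ⟨∑' n, deBruijnPhiMajorant n, tsum_nonneg deBruijnPhiMajorant_nonneg, fun s ↦ ?_⟩
  have h := abs_deBruijnPhi_le (abs_nonneg s)
  have h2 : Real.exp (9 * |s| - π * Real.exp (4 * |s|)) ≤ 1 :=
    Real.exp_le_one_iff.2 (by linarith [nine_mul_sub_pi_mul_exp_le (abs_nonneg s), Real.pi_pos])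
  calc evenPhi s ≤ |deBruijnPhi (|s|)| := le_abs_self _
    _ ≤ (∑' n, deBruijnPhiMajorant n) * Real.exp (9 * |s| - π * Real.exp (4 * |s|)) := h
    _ ≤ (∑' n, deBruijnPhiMajorant n) * 1 :=
        mul_le_mul_of_nonneg_left h2 (tsum_nonneg deBruijnPhiMajorant_nonneg)
    _ = ∑' n, deBruijnPhiMajorant n := mul_one _

/-- The Gaussian-convolution kernel identity behind Newman's (2.2):
`e^{−bt²/2} e^{−bu²/2} cosh(btu) = ½ (e^{−b(u−t)²/2} + e^{−b(u+t)²/2})`. [folklore] -/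
theorem gauss_cosh_identity (b t u : ℝ) :
    Real.exp (-(b * t ^ 2 / 2)) * (Real.exp (-(b / 2) * u ^ 2) * Real.cosh (b * t * u)) =
      (Real.exp (-(b / 2) * (u - t) ^ 2) + Real.exp (-(b / 2) * (u + t) ^ 2)) / 2 := by
  have h1 : Real.exp (-(b / 2) * (u - t) ^ 2) =
      Real.exp (-(b * t ^ 2 / 2)) * Real.exp (-(b / 2) * u ^ 2) * Real.exp (b * t * u) := by
    rw [← Real.exp_add, ← Real.exp_add]; congr 1; ring
  have h2 : Real.exp (-(b / 2) * (u + t) ^ 2) =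
      Real.exp (-(b * t ^ 2 / 2)) * Real.exp (-(b / 2) * u ^ 2) * Real.exp (-(b * t * u)) := by
    rw [← Real.exp_add, ← Real.exp_add]; congr 1; ring
  rw [h1, h2, Real.cosh_eq]
  ring

/-- `s ↦ e^{−b(s−t)²/2} Φ(|s|)` is integrable on `ℝ` (Gaussian times a bounded continuous
function). [folklore] -/
theorem integrable_gauss_mul_evenPhi {b : ℝ} (hb : 0 < b) (t : ℝ) :
    Integrable fun s : ℝ ↦ Real.exp (-(b / 2) * (s - t) ^ 2) * evenPhi s := by
  obtain ⟨C, -, hC⟩ := exists_evenPhi_le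
  have hg : Integrable fun s : ℝ ↦ Real.exp (-(b / 2) * (s - t) ^ 2) :=
    (integrable_exp_neg_mul_sq (by positivity : 0 < b / 2)).comp_sub_right t
  refine hg.mul_bdd (c := C) continuous_evenPhi.aestronglyMeasurable (ae_of_all _ fun s ↦ ?_)
  rw [Real.norm_eq_abs, abs_of_nonneg (evenPhi_nonneg s)]
  exact hC s

/-- `f_b(t) = (√b/2) ∫_ℝ e^{−b(s−t)²/2} Φ(|s|) ds`. [folklore] -/
theorem density_eq_integral {b : ℝ} (hb : 0 < b) (t : ℝ) :
    density b t = Real.sqrt b / 2 * ∫ s, Real.exp (-(b / 2) * (s - t) ^ 2) * evenPhi s := by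
  set k : ℝ → ℝ := fun u ↦
    (Real.exp (-(b / 2) * (u - t) ^ 2) + Real.exp (-(b / 2) * (u + t) ^ 2)) / 2 * evenPhi u with hk
  -- Step 1: `density b t = √b ∫₀^∞ k`.
  have h1 : density b t = Real.sqrt b * ∫ u in Ioi (0 : ℝ), k u := by
    rw [density, mul_assoc, coshTransform, ← integral_const_mul]
    congr 1
    refine setIntegral_congr_fun measurableSet_Ioi fun u (hu : 0 < u) ↦ ?_
    rw [hk]
    dsimp only
    rw [← gauss_cosh_identity, evenPhi_of_nonneg hu.le]
    ring
  -- Step 2: `∫₀^∞ k = ½ ∫_ℝ k` (`k` is even).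
  have hkeven : ∀ u, k |u| = k u := by
    intro u
    rcases le_or_gt 0 u with h | h
    · rw [abs_of_nonneg h]
    · simp only [hk, abs_of_neg h, evenPhi_neg]
      rw [show (-u - t) ^ 2 = (u + t) ^ 2 by ring, show (-u + t) ^ 2 = (u - t) ^ 2 by ring,
        add_comm]
  have h2 : ∫ u in Ioi (0 : ℝ), k u = (1 / 2) * ∫ u, k u := by
    have := integral_comp_abs (f := k)
    simp_rw [hkeven] at this
    rw [this]; ring
  -- Step 3: `∫_ℝ k = ∫_ℝ e^{−b(s−t)²/2} evenPhi`.
  have hint := integrable_gauss_mul_evenPhi hb t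
  have hint' : Integrable fun s : ℝ ↦ Real.exp (-(b / 2) * (s + t) ^ 2) * evenPhi s := by
    have := hint.comp_neg
    refine this.congr (ae_of_all _ fun s ↦ ?_)
    simp only [evenPhi_neg]
    rw [show (-s - t) ^ 2 = (s + t) ^ 2 by ring]
  have h3 : ∫ u, k u = ∫ s, Real.exp (-(b / 2) * (s - t) ^ 2) * evenPhi s := by
    have hsplit : ∀ u, k u = (1 / 2) * (Real.exp (-(b / 2) * (u - t) ^ 2) * evenPhi u) +
        (1 / 2) * (Real.exp (-(b / 2) * (u + t) ^ 2) * evenPhi u) := fun u ↦ by rw [hk]; ring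
    simp_rw [hsplit]
    rw [integral_add (hint.const_mul _) (hint'.const_mul _), integral_const_mul, integral_const_mul]
    have hneg : ∫ s, Real.exp (-(b / 2) * (s + t) ^ 2) * evenPhi s =
        ∫ s, Real.exp (-(b / 2) * (s - t) ^ 2) * evenPhi s := by
      rw [← integral_neg_eq_self (fun s ↦ Real.exp (-(b / 2) * (s - t) ^ 2) * evenPhi s)]
      congr 1; funext s
      rw [evenPhi_neg, show (-s - t) ^ 2 = (s + t) ^ 2 by ring]
    rw [hneg]; ring
  rw [h1, h2, h3]; ring

/-- Substituting `s = t + v/√b`: `f_b(t) = ½ ∫_ℝ e^{−v²/2} Φ(|t + v/√b|) dv`. [folklore] -/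
theorem density_eq_integral' {b : ℝ} (hb : 0 < b) (t : ℝ) :
    density b t = (1 / 2) * ∫ v, Real.exp (-(v ^ 2 / 2)) * evenPhi (t + v / Real.sqrt b) := by
  have hsb : 0 < Real.sqrt b := Real.sqrt_pos.2 hb
  have hsq : Real.sqrt b ^ 2 = b := Real.sq_sqrt hb.le
  set g : ℝ → ℝ := fun u ↦ Real.exp (-(b / 2) * u ^ 2) * evenPhi (t + u) with hg
  have h1 : (fun v ↦ Real.exp (-(v ^ 2 / 2)) * evenPhi (t + v / Real.sqrt b)) =
      fun v ↦ g ((Real.sqrt b)⁻¹ * v) := by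
    funext v
    simp only [hg]
    rw [div_eq_inv_mul]
    congr 2
    rw [mul_pow, inv_pow, hsq]
    field_simp
    ring
  have h2 : ∫ v, g ((Real.sqrt b)⁻¹ * v) = Real.sqrt b * ∫ u, g u := by
    rw [Measure.integral_comp_inv_mul_left, abs_of_pos hsb, smul_eq_mul]
  have h3 : ∫ u, g u = ∫ s, Real.exp (-(b / 2) * (s - t) ^ 2) * evenPhi s := by
    rw [← integral_add_left_eq_self (fun s ↦ Real.exp (-(b / 2) * (s - t) ^ 2) * evenPhi s) t]
    congr 1; funext u
    simp [hg]
  rw [h1, h2, h3, density_eq_integral hb]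
  ring

/-- The normalising constant `gaussConst = ½ ∫ e^{−v²/2} dv = √(π/2) > 0`. [folklore] -/
def gaussConst : ℝ := (1 / 2) * ∫ v : ℝ, Real.exp (-(v ^ 2 / 2))

/-- `c₀ > 0` (`∫ e^{−v²/2} dv = √(2π)`, `integral_gaussian`). [folklore] -/
theorem gaussConst_pos : 0 < gaussConst := by
  have h : ∫ v : ℝ, Real.exp (-(v ^ 2 / 2)) = ∫ v : ℝ, Real.exp (-(1 / 2) * v ^ 2) := by
    congr 1; funext v; ring_nf
  rw [gaussConst, h, integral_gaussian]
  have : 0 < Real.sqrt (π / (1 / 2)) := Real.sqrt_pos.2 (by positivity)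
  positivity

/-- **The mollifier limit**: `f_b(t) → c₀ Φ(|t|)` (`c₀ = gaussConst`) as `b → ∞`, for every real `t`. [cite: NewmanPAMS1976, §2 Lemma 1] -/
theorem tendsto_density (t : ℝ) : Tendsto (fun b ↦ density b t) atTop (𝓝 (gaussConst * evenPhi t)) := by
  obtain ⟨C, hC0, hC⟩ := exists_evenPhi_le
  have hev : (fun b ↦ density b t) =ᶠ[atTop]
      fun b ↦ (1 / 2) * ∫ v, Real.exp (-(v ^ 2 / 2)) * evenPhi (t + v / Real.sqrt b) := by
    filter_upwards [eventually_gt_atTop 0] with b hb using density_eq_integral' hb t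
  refine (Tendsto.congr' hev.symm ?_)
  have hlim : Tendsto (fun b : ℝ ↦ ∫ v, Real.exp (-(v ^ 2 / 2)) * evenPhi (t + v / Real.sqrt b)) atTop
      (𝓝 (∫ v, Real.exp (-(v ^ 2 / 2)) * evenPhi t)) := by
    refine tendsto_integral_filter_of_dominated_convergence
      (fun v ↦ Real.exp (-(v ^ 2 / 2)) * C) ?_ ?_ ?_ ?_
    · refine Eventually.of_forall fun b ↦ Continuous.aestronglyMeasurable ?_
      exact (by fun_prop : Continuous fun v : ℝ ↦ Real.exp (-(v ^ 2 / 2))).mul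
        (continuous_evenPhi.comp (by fun_prop))
    · refine Eventually.of_forall fun b ↦ ae_of_all _ fun v ↦ ?_
      rw [Real.norm_eq_abs, abs_mul, abs_of_pos (Real.exp_pos _), abs_of_nonneg (evenPhi_nonneg _)]
      gcongr
      exact hC _
    · have : Integrable fun v : ℝ ↦ Real.exp (-(1 / 2) * v ^ 2) :=
        integrable_exp_neg_mul_sq (by norm_num)
      refine (this.mul_const C).congr (ae_of_all _ fun v ↦ ?_)
      simp only; ring_nf
    · refine ae_of_all _ fun v ↦ ?_
      refine Tendsto.const_mul _ (continuous_evenPhi.continuousAt.tendsto.comp ?_)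
      have h0 : Tendsto (fun b : ℝ ↦ v / Real.sqrt b) atTop (𝓝 0) := by
        have := (tendsto_inv_atTop_zero.comp
          (Real.tendsto_sqrt_atTop)).const_mul v
        simpa [div_eq_mul_inv] using this
      simpa using h0.const_add t
  have := hlim.const_mul (1 / 2 : ℝ)
  rw [integral_mul_const] at this
  convert this using 2
  rw [gaussConst]; ring


/-! ### Newman's inequalities for `V_b = −log f_b` (Newman 1976, (2.4)–(2.5), (2.16)–(2.18)) -/

section Elementary

/-- `log(1 + 4x) − log(1 + x) ≤ 3x/(1 + x)` (`log y ≤ y − 1`). [folklore] -/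
theorem log_ineq₁ {x : ℝ} (hx : 0 ≤ x) :
    Real.log (1 + x * 2 ^ 2) - Real.log (1 + x * 1 ^ 2) ≤ 3 * x / (1 + x) := by
  have h1 : 0 < 1 + x := by linarith
  have h4 : 0 < 1 + x * 2 ^ 2 := by positivity
  rw [show x * 1 ^ 2 = x by ring, ← Real.log_div h4.ne' h1.ne']
  refine (Real.log_le_sub_one_of_pos (div_pos h4 h1)).trans (le_of_eq ?_)
  field_simp; ring

/-- `log(1 + 9x) − log(1 + 4x) ≤ 5x/(1 + 4x)`. [folklore] -/
theorem log_ineq₂ {x : ℝ} (hx : 0 ≤ x) :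
    Real.log (1 + x * 3 ^ 2) - Real.log (1 + x * 2 ^ 2) ≤ 5 * x / (1 + 4 * x) := by
  have h4 : 0 < 1 + x * 2 ^ 2 := by positivity
  have h9 : 0 < 1 + x * 3 ^ 2 := by positivity
  rw [← Real.log_div h9.ne' h4.ne']
  refine (Real.log_le_sub_one_of_pos (div_pos h9 h4)).trans (le_of_eq ?_)
  field_simp; ring

/-- `(3/4) x/(1 + x) ≤ log(1 + x) − log(1 + x/4)` (`1 − 1/y ≤ log y`). [folklore] -/
theorem log_ineq₃ {x : ℝ} (hx : 0 ≤ x) :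
    3 / 4 * (x / (1 + x)) ≤ Real.log (1 + x * 1 ^ 2) - Real.log (1 + x * (1 / 2) ^ 2) := by
  have h1 : 0 < 1 + x * 1 ^ 2 := by positivity
  have hq : 0 < 1 + x * (1 / 2) ^ 2 := by positivity
  rw [← Real.log_div h1.ne' hq.ne']
  refine (le_of_eq ?_).trans (Real.one_sub_inv_le_log_of_pos (div_pos h1 hq))
  field_simp; ring

/-- `(3/4) (x/(1+x))² ≤ x/(1 + x) − x/(1 + 4x)`. [folklore] -/
theorem alg_ineq₄ {x : ℝ} (hx : 0 ≤ x) :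
    3 / 4 * (x / (1 + x)) ^ 2 ≤ x / (1 + x) - x / (1 + 4 * x) := by
  have h1 : 0 < 1 + x := by linarith
  have h4 : 0 < 1 + 4 * x := by linarith
  rw [← sub_nonneg]
  have : x / (1 + x) - x / (1 + 4 * x) - 3 / 4 * (x / (1 + x)) ^ 2 =
      9 * x ^ 2 / (4 * (1 + x) ^ 2 * (1 + 4 * x)) := by
    field_simp; ring
  rw [this]; positivity

/-- For `s ≥ 1`: `x(s−1)/(1+x) − (log(1 + xs) − log(1 + x)) ≤ (x/(1+x))² s²`. [folklore] -/
theorem log_ineq₅ {x s : ℝ} (hx : 0 ≤ x) (hs : 1 ≤ s) :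
    x * (s - 1) / (1 + x) - (Real.log (1 + x * s) - Real.log (1 + x * 1 ^ 2)) ≤
      (x / (1 + x)) ^ 2 * s ^ 2 := by
  have h1 : 0 < 1 + x := by linarith
  have hs' : 0 < 1 + x * s := by nlinarith
  set y : ℝ := (1 + x * s) / (1 + x) with hy
  have hy0 : 0 < y := div_pos hs' h1
  have hy1 : 1 ≤ y := by rw [hy, le_div_iff₀ h1]; nlinarith
  have hlog : 1 - y⁻¹ ≤ Real.log y := Real.one_sub_inv_le_log_of_pos hy0
  rw [show x * 1 ^ 2 = x by ring, ← Real.log_div hs'.ne' h1.ne', ← hy]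
  have e1 : x * (s - 1) / (1 + x) = y - 1 := by rw [hy]; field_simp; ring
  rw [e1]
  calc y - 1 - Real.log y ≤ y - 1 - (1 - y⁻¹) := by linarith
    _ = (y - 1) ^ 2 / y := by field_simp
    _ ≤ (y - 1) ^ 2 := div_le_self (sq_nonneg _) hy1
    _ = (x / (1 + x)) ^ 2 * (s - 1) ^ 2 := by rw [← e1]; field_simp
    _ ≤ (x / (1 + x)) ^ 2 * s ^ 2 := by
        have h2 : (s - 1) ^ 2 ≤ s ^ 2 := by nlinarith
        exact mul_le_mul_of_nonneg_left h2 (sq_nonneg _)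

variable {α : ℕ → ℝ}

/-- `logPotential t = B t² − ∑ₙ log(1 + αₙ t²)`, i.e. `−log f_b(t)` up to an additive constant. [folklore] -/
def logPotential (α : ℕ → ℝ) (B t : ℝ) : ℝ := B * t ^ 2 - ∑' n, Real.log (1 + α n * t ^ 2)

/-- `∑ αₙ/(1 + c αₙ) < ∞`. [folklore] -/
theorem summable_div_one_add (hα0 : ∀ n, 0 ≤ α n) (hα : Summable α) (c : ℝ) (hc : 0 ≤ c) :
    Summable fun n ↦ α n / (1 + c * α n) := by
  refine Summable.of_nonneg_of_le (fun n ↦ ?_) (fun n ↦ ?_) hα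
  · have := hα0 n; positivity
  · exact div_le_self (hα0 n) (by nlinarith [hα0 n])

/-- `∑ (αₙ/(1 + αₙ))² < ∞`. [folklore] -/
theorem summable_sq_div (hα0 : ∀ n, 0 ≤ α n) (hα : Summable α) :
    Summable fun n ↦ (α n / (1 + α n)) ^ 2 := by
  refine Summable.of_nonneg_of_le (fun n ↦ sq_nonneg _) (fun n ↦ ?_) hα
  have h0 := hα0 n
  have h1 : α n / (1 + α n) ≤ 1 := by rw [div_le_one (by linarith)]; linarith
  have h2 : α n / (1 + α n) ≤ α n := div_le_self h0 (by linarith)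
  calc (α n / (1 + α n)) ^ 2 = (α n / (1 + α n)) * (α n / (1 + α n)) := sq _
    _ ≤ 1 * α n := by gcongr
    _ = α n := one_mul _

/-- `V(t) − V(t') = B(t² − t'²) − ∑ₙ (log(1 + αₙt²) − log(1 + αₙt'²))`. [folklore] -/
theorem logPotential_sub (hα0 : ∀ n, 0 ≤ α n) (hα : Summable α) (B t t' : ℝ) :
    logPotential α B t - logPotential α B t' = B * (t ^ 2 - t' ^ 2) -
      ∑' n, (Real.log (1 + α n * t ^ 2) - Real.log (1 + α n * t' ^ 2)) := by
  rw [logPotential, logPotential, (summable_log_one_add hα0 hα t).tsum_sub (summable_log_one_add hα0 hα t')]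
  ring

/-- **Newman's key inequality** (from (2.5), (2.16)–(2.18), specialised and made effective): for
`t ≥ 1`, `logPotential(t) − logPotential(1)` is bounded by `t⁴` times a fixed combination of the four values
`V(1/2), V(1), V(2), V(3)` (`V = logPotential α B`). [cite: NewmanPAMS1976, (2.16)–(2.18)] -/
theorem logPotential_sub_one_le (hα0 : ∀ n, 0 ≤ α n) (hα : Summable α) (B : ℝ) {t : ℝ} (ht : 1 ≤ t) :
    logPotential α B t - logPotential α B 1 ≤ (max ((logPotential α B 2 - logPotential α B 1) / 3) 0 +
      4 / 3 * ((logPotential α B 3 - logPotential α B 2) / 5 - 4 / 3 * (logPotential α B 1 - logPotential α B (1 / 2)))) * t ^ 4 := by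
  -- the auxiliary quantities
  set g₁ : ℝ := B - ∑' n, α n / (1 + 1 * α n) with hg₁
  set g₂ : ℝ := B - ∑' n, α n / (1 + 4 * α n) with hg₂
  set A : ℝ := ∑' n, (α n / (1 + α n)) ^ 2 with hA
  have hs1 := summable_div_one_add hα0 hα 1 zero_le_one
  have hs4 := summable_div_one_add hα0 hα 4 (by norm_num)
  have hsA := summable_sq_div hα0 hα
  have hA0 : 0 ≤ A := tsum_nonneg fun n ↦ sq_nonneg _
  -- (I1) `3 g₁ ≤ logPotential 2 − logPotential 1`
  have I1 : 3 * g₁ ≤ logPotential α B 2 - logPotential α B 1 := by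
    rw [logPotential_sub hα0 hα, hg₁, mul_sub, ← tsum_mul_left]
    have : ∑' n, (Real.log (1 + α n * 2 ^ 2) - Real.log (1 + α n * 1 ^ 2)) ≤
        ∑' n, 3 * (α n / (1 + 1 * α n)) := by
      refine Summable.tsum_le_tsum (fun n ↦ ?_) ((summable_log_one_add hα0 hα 2).sub (summable_log_one_add hα0 hα 1))
        (hs1.mul_left 3)
      rw [one_mul, ← mul_div_assoc]
      exact log_ineq₁ (hα0 n)
    linarith
  -- (I2) `5 g₂ ≤ logPotential 3 − logPotential 2`
  have I2 : 5 * g₂ ≤ logPotential α B 3 - logPotential α B 2 := by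
    rw [logPotential_sub hα0 hα, hg₂, mul_sub, ← tsum_mul_left]
    have : ∑' n, (Real.log (1 + α n * 3 ^ 2) - Real.log (1 + α n * 2 ^ 2)) ≤
        ∑' n, 5 * (α n / (1 + 4 * α n)) := by
      refine Summable.tsum_le_tsum (fun n ↦ ?_) ((summable_log_one_add hα0 hα 3).sub (summable_log_one_add hα0 hα 2))
        (hs4.mul_left 5)
      rw [← mul_div_assoc]
      exact log_ineq₂ (hα0 n)
    linarith
  -- (I3) `logPotential 1 − logPotential (1/2) ≤ (3/4) g₁`
  have I3 : logPotential α B 1 - logPotential α B (1 / 2) ≤ 3 / 4 * g₁ := by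
    rw [logPotential_sub hα0 hα, hg₁, mul_sub (3 / 4 : ℝ), ← tsum_mul_left]
    have : ∑' n, 3 / 4 * (α n / (1 + 1 * α n)) ≤
        ∑' n, (Real.log (1 + α n * 1 ^ 2) - Real.log (1 + α n * (1 / 2) ^ 2)) := by
      refine Summable.tsum_le_tsum (fun n ↦ ?_) (hs1.mul_left _)
        ((summable_log_one_add hα0 hα 1).sub (summable_log_one_add hα0 hα (1 / 2)))
      rw [one_mul]
      exact log_ineq₃ (hα0 n)
    linarith
  -- (I4) `(3/4) A ≤ g₂ − g₁`
  have I4 : 3 / 4 * A ≤ g₂ - g₁ := by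
    rw [hg₁, hg₂, hA, ← tsum_mul_left, sub_sub_sub_cancel_left, ← hs1.tsum_sub hs4]
    refine Summable.tsum_le_tsum (fun n ↦ ?_) (hsA.mul_left _) (hs1.sub hs4)
    rw [one_mul]
    exact alg_ineq₄ (hα0 n)
  -- (I5) `logPotential t − logPotential 1 ≤ g₁ (t² − 1) + A t⁴`
  have I5 : logPotential α B t - logPotential α B 1 ≤ g₁ * (t ^ 2 - 1) + A * t ^ 4 := by
    have hs : (1 : ℝ) ≤ t ^ 2 := by nlinarith
    rw [logPotential_sub hα0 hα, hg₁, hA, sub_mul, ← tsum_mul_right, ← tsum_mul_right]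
    have hsum : Summable fun n ↦ α n / (1 + 1 * α n) * (t ^ 2 - 1) -
        (Real.log (1 + α n * t ^ 2) - Real.log (1 + α n * 1 ^ 2)) :=
      (hs1.mul_right _).sub ((summable_log_one_add hα0 hα t).sub (summable_log_one_add hα0 hα 1))
    have key : ∑' n, (α n / (1 + 1 * α n) * (t ^ 2 - 1) -
        (Real.log (1 + α n * t ^ 2) - Real.log (1 + α n * 1 ^ 2))) ≤
        ∑' n, (α n / (1 + α n)) ^ 2 * t ^ 4 := by
      refine Summable.tsum_le_tsum (fun n ↦ ?_) hsum (hsA.mul_right _)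
      have := log_ineq₅ (hα0 n) hs
      rw [one_mul, div_mul_eq_mul_div, show t ^ 4 = (t ^ 2) ^ 2 by ring]
      exact this
    rw [(hs1.mul_right _).tsum_sub ((summable_log_one_add hα0 hα t).sub (summable_log_one_add hα0 hα 1))] at key
    norm_num at key ⊢
    linarith
  -- assembly
  have hs0 : 0 ≤ t ^ 2 - 1 := by nlinarith
  have hs2 : t ^ 2 - 1 ≤ t ^ 4 := by nlinarith
  have ht4 : 0 ≤ t ^ 4 := by positivity
  have J1 : g₁ * (t ^ 2 - 1) ≤ max ((logPotential α B 2 - logPotential α B 1) / 3) 0 * t ^ 4 := by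
    calc g₁ * (t ^ 2 - 1) ≤ max g₁ 0 * (t ^ 2 - 1) :=
          mul_le_mul_of_nonneg_right (le_max_left _ _) hs0
      _ ≤ max g₁ 0 * t ^ 4 := mul_le_mul_of_nonneg_left hs2 (le_max_right _ _)
      _ ≤ max ((logPotential α B 2 - logPotential α B 1) / 3) 0 * t ^ 4 := by
          gcongr
          linarith
  have J2 : A ≤ 4 / 3 * ((logPotential α B 3 - logPotential α B 2) / 5 - 4 / 3 * (logPotential α B 1 - logPotential α B (1 / 2))) := by
    have : g₂ - g₁ ≤ (logPotential α B 3 - logPotential α B 2) / 5 - 4 / 3 * (logPotential α B 1 - logPotential α B (1 / 2)) := by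
      linarith
    linarith
  calc logPotential α B t - logPotential α B 1 ≤ g₁ * (t ^ 2 - 1) + A * t ^ 4 := I5
    _ ≤ max ((logPotential α B 2 - logPotential α B 1) / 3) 0 * t ^ 4 +
        4 / 3 * ((logPotential α B 3 - logPotential α B 2) / 5 - 4 / 3 * (logPotential α B 1 - logPotential α B (1 / 2))) * t ^ 4 := by
          gcongr
    _ = _ := by ring

end Elementary



/-! ### Newman's theorem: some `H_t` has a non-real zero -/

/-- Super-exponential decay of `Φ` beats every `exp(−M t⁴)`. [folklore] -/
theorem deBruijnPhi_decay (M : ℝ) :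
    ∃ t : ℝ, 1 ≤ t ∧ deBruijnPhi t < deBruijnPhi 1 * Real.exp (-(M * t ^ 4)) := by
  obtain ⟨C, hC⟩ := deBruijnPhi_le_exp_holds
  have hΦ1 : 0 < deBruijnPhi 1 := deBruijnPhi_pos_of_nonneg zero_le_one
  set L : ℝ := Real.log (deBruijnPhi 1 / C) with hL
  set t : ℝ := max 1 ((9 + |M| + |L| + 1) / 24) with ht
  have ht1 : 1 ≤ t := le_max_left _ _
  have ht0 : 0 ≤ t := zero_le_one.trans ht1
  refine ⟨t, ht1, ?_⟩
  rcases le_or_gt C 0 with hC0 | hC0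
  · calc deBruijnPhi t ≤ C * Real.exp (9 * t - π * Real.exp (4 * t)) := hC t ht0
      _ ≤ 0 := mul_nonpos_of_nonpos_of_nonneg hC0 (Real.exp_pos _).le
      _ < deBruijnPhi 1 * Real.exp (-(M * t ^ 4)) := by positivity
  · have h24 : 9 + |M| + |L| + 1 ≤ 24 * t := by
      have := le_max_right 1 ((9 + |M| + |L| + 1) / 24)
      rw [← ht] at this
      linarith
    have hexp : 8 * t ^ 5 ≤ Real.exp (4 * t) := by
      have h := Real.pow_div_factorial_le_exp (x := 4 * t) (by linarith) 5
      have h5 : (Nat.factorial 5 : ℝ) = 120 := by norm_num [Nat.factorial]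
      rw [h5, div_le_iff₀ (by norm_num : (0 : ℝ) < 120)] at h
      nlinarith [pow_nonneg ht0 5]
    have ht4 : 1 ≤ t ^ 4 := one_le_pow₀ ht1
    have hkey : 9 * t - π * Real.exp (4 * t) + M * t ^ 4 < L := by
      have h1 : 9 * t ≤ 9 * t ^ 4 := by linarith [le_self_pow₀ ht1 (by norm_num : (4 : ℕ) ≠ 0)]
      have h2 : M * t ^ 4 ≤ |M| * t ^ 4 := mul_le_mul_of_nonneg_right (le_abs_self M) (by positivity)
      have h3 : 24 * t ^ 5 ≤ π * Real.exp (4 * t) := by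
        nlinarith [Real.pi_gt_three, hexp, pow_nonneg ht0 5, Real.exp_pos (4 * t)]
      have h4 : (9 + |M|) * t ^ 4 - 24 * t ^ 5 ≤ -(|L| + 1) * t ^ 4 := by
        have : (9 + |M|) * t ^ 4 - 24 * t ^ 5 = (9 + |M| - 24 * t) * t ^ 4 := by ring
        rw [this]
        exact mul_le_mul_of_nonneg_right (by linarith) (by positivity)
      have h5 : -(|L| + 1) * t ^ 4 ≤ -(|L| + 1) := by nlinarith [abs_nonneg L]
      have h6 : -(|L| + 1) < L := by linarith [neg_abs_le L]
      linarith
    calc deBruijnPhi t ≤ C * Real.exp (9 * t - π * Real.exp (4 * t)) := hC t ht0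
      _ < C * Real.exp (L - M * t ^ 4) :=
          mul_lt_mul_of_pos_left (Real.exp_lt_exp.2 (by linarith)) hC0
      _ = deBruijnPhi 1 * Real.exp (-(M * t ^ 4)) := by
          rw [sub_eq_add_neg, Real.exp_add, hL, Real.exp_log (div_pos hΦ1 hC0)]
          field_simp

/-- The combination of the four values `W(1/2), W(1), W(2), W(3)` bounding `(W(t) − W(1))/t⁴`
in `logPotential_sub_one_le` (with `W = −log f`). [folklore] -/
def fourPoint (W : ℝ → ℝ) : ℝ :=
  max ((W 2 - W 1) / 3) 0 + 4 / 3 * ((W 3 - W 2) / 5 - 4 / 3 * (W 1 - W (1 / 2)))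

/-- `Q` is continuous in the four values it depends on. [folklore] -/
theorem tendsto_fourPoint {W : ℝ → ℝ → ℝ} {W₀ : ℝ → ℝ} {l : Filter ℝ}
    (h : ∀ t, Tendsto (fun b ↦ W b t) l (𝓝 (W₀ t))) :
    Tendsto (fun b ↦ fourPoint (W b)) l (𝓝 (fourPoint W₀)) := by
  unfold fourPoint
  refine Tendsto.add (Tendsto.max (((h 2).sub (h 1)).div_const 3) tendsto_const_nhds)
    (Tendsto.const_mul _ (Tendsto.sub (((h 3).sub (h 2)).div_const 5)
      (Tendsto.const_mul _ ((h 1).sub (h (1 / 2))))))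

/-- **Newman 1976, Theorem 3** (the part `b₀ < ∞`, i.e. `Λ > −∞`), from Hadamard's factorisation
theorem in genus zero: some `H_t` has a non-real zero — the named fact
`Literature.NumberTheory.LFunctions.exists_not_hasOnlyRealZeros_deBruijnH` of `EquivalentsProofs.lean`. [cite: NewmanPAMS1976, Thm. 3] -/
theorem exists_not_hasOnlyRealZeros_deBruijnH_of_hadamard (hH : Literature.Analysis.Complex.hadamard_genus_zero) :
    LFunctions.exists_not_hasOnlyRealZeros_deBruijnH := by
  unfold LFunctions.exists_not_hasOnlyRealZeros_deBruijnH
  by_contra hcon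
  push Not at hcon
  -- `W b t = −log f_b(t)`
  set W : ℝ → ℝ → ℝ := fun b t ↦ -Real.log (density b t) with hW
  -- Step 1: Newman's inequality for every `b > 0` and `t ≥ 1`.
  have hQ : ∀ b : ℝ, 0 < b → ∀ t : ℝ, 1 ≤ t → W b t - W b 1 ≤ fourPoint (W b) * t ^ 4 := by
    intro b hb t ht
    obtain ⟨κ, α, hα0, hα, hF⟩ := density_rep hH hb (hcon _)
    have hV : ∀ s, logPotential α (b / 2) s = κ + W b s := fun s ↦ by
      simp only [hW, logPotential, (hF s).2]; ring
    have key := logPotential_sub_one_le hα0 hα (b / 2) ht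
    simp only [hV] at key
    have e1 : (κ + W b 2 - (κ + W b 1)) / 3 = (W b 2 - W b 1) / 3 := by ring
    have e2 : (κ + W b 3 - (κ + W b 2)) / 5 - 4 / 3 * (κ + W b 1 - (κ + W b (1 / 2))) =
        (W b 3 - W b 2) / 5 - 4 / 3 * (W b 1 - W b (1 / 2)) := by ring
    rw [e1, e2] at key
    simp only [fourPoint]
    linarith
  -- Step 2: the limit `b → ∞`.
  set W₀ : ℝ → ℝ := fun t ↦ -Real.log (gaussConst * evenPhi t) with hW₀
  have hpos : ∀ t, 0 < gaussConst * evenPhi t := fun t ↦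
    mul_pos gaussConst_pos (deBruijnPhi_pos_of_nonneg (abs_nonneg t))
  have hlim : ∀ t, Tendsto (fun b ↦ W b t) atTop (𝓝 (W₀ t)) := fun t ↦
    ((tendsto_density t).log (hpos t).ne').neg
  have hQlim : Tendsto (fun b ↦ fourPoint (W b)) atTop (𝓝 (fourPoint W₀)) := tendsto_fourPoint hlim
  set M : ℝ := fourPoint W₀ + 1 with hM
  have hQev : ∀ᶠ b in atTop, fourPoint (W b) ≤ M := hQlim.eventually (Iic_mem_nhds (lt_add_one _))
  -- Step 3: `W₀ t − W₀ 1 ≤ M t⁴` for all `t ≥ 1`.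
  have hW₀le : ∀ t : ℝ, 1 ≤ t → W₀ t - W₀ 1 ≤ M * t ^ 4 := by
    intro t ht
    refine le_of_tendsto ((hlim t).sub (hlim 1)) ?_
    filter_upwards [hQev, eventually_gt_atTop 0] with b hb hb0
    exact (hQ b hb0 t ht).trans (mul_le_mul_of_nonneg_right hb (by positivity))
  -- Step 4: contradiction with the decay of `Φ`.
  obtain ⟨t, ht1, hlt⟩ := deBruijnPhi_decay M
  have ht0 : 0 ≤ t := zero_le_one.trans ht1
  have h := hW₀le t ht1
  simp only [hW₀, evenPhi, abs_of_nonneg ht0, abs_one] at h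
  rw [Real.log_mul gaussConst_pos.ne' (deBruijnPhi_pos_of_nonneg ht0).ne',
    Real.log_mul gaussConst_pos.ne' (deBruijnPhi_pos_of_nonneg zero_le_one).ne'] at h
  -- `log Φ 1 − log Φ t ≤ M t⁴` contradicts `Φ t < Φ 1 e^{−M t⁴}`
  have hΦt : 0 < deBruijnPhi t := deBruijnPhi_pos_of_nonneg ht0
  have hΦ1 : 0 < deBruijnPhi 1 := deBruijnPhi_pos_of_nonneg zero_le_one
  have h2 : Real.log (deBruijnPhi t) < Real.log (deBruijnPhi 1) + -(M * t ^ 4) := by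
    have := Real.log_lt_log hΦt hlt
    rwa [Real.log_mul hΦ1.ne' (Real.exp_pos _).ne', Real.log_exp] at this
  linarith


end Newman

end Literature.NumberTheory.LFunctions
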